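import Summits.Ventures.PercRepro.SevenThreeBookkeeping
import Summits.Ventures.PercRepro.SevenThreeSeriesClasses

/-!
# PercRepro — the `(7,3)` cell: the reduced world through its dual rank (p3, gen 16)

In a reduced world `ReducedWorld M T W` of a rank-`7` matroid (`SevenThreeBookkeeping.lean`) put `E = T ∪ W`
(`10` points, rank `7`). For `X ⊆ W` and `Z = W ∖ X` the witness `S = T ∪ X = E ∖ Z` has nullity
`|S| − ρ(S) = 3 − drk E Z` (`nullity_eq`), where `drk` is the dual rank of `SevenThreeSeries.lean`. The coloops `L₀`
of `E` lie in `W` and number at most `3` (`coloopsOf_world_subset`, `card_coloopsOf_world_le`), and a nullity-two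
witness is described by the SERIES CLASS `N` of `E` containing `Z ∖ L₀` (`drk_eq_one_iff_subset_serClass`): its
cyclic part is `K_N = E ∖ (N ∪ L₀)` and its coloops are `(N ∪ L₀) ∖ Z` (`cyclicPart_of_drk_one`,
`coloopsOf_of_drk_one`) — the same cyclic part for every witness of the fibre of `N`, the input of the star table
through `D_eq_DstarN` (`SevenThreeDstar.lean`). (`P3-C025-seven-three-plan.md` §9 (R3)(b).)
-/

namespace PercRepro

namespace SevenThree

open Finset ThmH SixThree

variable {α : Type*} [DecidableEq α] {M : Matroid α} [M.Finite]

/-- The world `E = T ∪ W` is contained in the ground set. -/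
theorem world_subset {T W : Finset α} (h : ReducedWorld M T W) : T ∪ W ⊆ gr M :=
  Finset.union_subset h.T_sub h.W_sub

/-- `|T ∪ W| = 10`. -/
theorem card_world {T W : Finset α} (h : ReducedWorld M T W) : (T ∪ W).card = 10 := by
  rw [Finset.card_union_of_disjoint h.disj, h.T_card, h.W_card]

/-- The world has rank `7` when `M` has rank `7`. -/
theorem nrk_world {T W : Finset α} (h : ReducedWorld M T W) (hr : M.eRank = 7) : nrk M (T ∪ W) = 7 := by
  have h1 : nrk M W = 7 := by
    apply nrk_eq_of_eRk
    rw [h.W_indep.eRk_eq_encard, Set.encard_coe_eq_coe_finsetCard, h.W_card]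
  have h2 : nrk M W ≤ nrk M (T ∪ W) := nrk_mono Finset.subset_union_right
  have h3 : nrk M (T ∪ W) ≤ 7 := by
    have := M.eRk_le_eRank ((T ∪ W : Finset α) : Set α)
    rw [hr, ← coe_nrk] at this
    exact_mod_cast this
  omega

/-- `E ∖ (W ∖ X) = T ∪ X` for `X ⊆ W`. -/
theorem world_sdiff_eq {T W X : Finset α} (h : ReducedWorld M T W) (hX : X ⊆ W) : (T ∪ W) \ (W \ X) = T ∪ X := by
  ext e
  simp only [Finset.mem_sdiff, Finset.mem_union, not_and, not_not]
  constructor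
  · rintro ⟨he, hh⟩
    rcases he with he | he
    · exact Or.inl he
    · exact Or.inr (hh he)
  · rintro (he | he)
    · exact ⟨Or.inl he, fun hw => absurd (Finset.disjoint_left.1 h.disj he) (fun hh => hh hw)⟩
    · exact ⟨Or.inr (hX he), fun _ => he⟩

/-- **The nullity of a witness**: `|T ∪ X| = ρ(T ∪ X) + 3 − drk E (W ∖ X)`, i.e. `ρ(T ∪ X) + 3 = |T ∪ X| + drk E (W ∖ X)`. -/
theorem nrk_witness_add_three {T W X : Finset α} (h : ReducedWorld M T W) (hr : M.eRank = 7) (hX : X ⊆ W) :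
    nrk M (T ∪ X) + 3 = (T ∪ X).card + drk M (T ∪ W) (W \ X) := by
  have h1 := nrk_sdiff_add_card_eq (M := M) (T ∪ W) (W \ X)
  rw [world_sdiff_eq h hX, nrk_world h hr] at h1
  have h2 : (T ∪ X).card + (W \ X).card = 10 := by
    rw [Finset.card_union_of_disjoint (h.disj.mono_right hX), Finset.card_sdiff_of_subset hX, h.T_card, h.W_card]
    have := Finset.card_le_card hX
    have hW7 := h.W_card
    omega
  omega

/-- The coloops of the world lie in `W` (a point of `T` is spanned by the basis `W`). -/
theorem coloopsOf_world_subset {T W : Finset α} (h : ReducedWorld M T W) (hr : M.eRank = 7) :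
    coloopsOf M (T ∪ W) ⊆ W := by
  intro y hy
  rw [mem_coloopsOf_iff_nrk (world_subset h)] at hy
  by_contra hyW
  have hyT : y ∈ T := by
    rcases Finset.mem_union.1 hy.1 with hh | hh
    · exact hh
    · exact absurd hh hyW
  have hsub : W ⊆ (T ∪ W).erase y := by
    intro w hw
    rw [Finset.mem_erase]
    exact ⟨fun hh => hyW (hh ▸ hw), Finset.mem_union_right T hw⟩
  have h1 : nrk M W ≤ nrk M ((T ∪ W).erase y) := nrk_mono hsub
  have h2 : nrk M W = 7 := by
    apply nrk_eq_of_eRk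
    rw [h.W_indep.eRk_eq_encard, Set.encard_coe_eq_coe_finsetCard, h.W_card]
  have h3 := nrk_world h hr
  omega

/-- A point of `W` outside `cl(T)` together with `T` has rank `4`: no point of `W` is spanned by `T`. -/
theorem nrk_insert_T {T W : Finset α} (h : ReducedWorld M T W) {w : α} (hw : w ∈ W) : nrk M (insert w T) = 4 := by
  apply nrk_eq_of_eRk
  rw [eRk_insert_eq_succ_of_notMem_closure (h.W_sub hw) (h.flat w hw), h.T_rank]
  rfl

/-- The world has at most `3` coloops: with `4` coloops the remaining points of `W` would be spanned by `T`. -/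
theorem card_coloopsOf_world_le {T W : Finset α} (h : ReducedWorld M T W) (hr : M.eRank = 7) :
    (coloopsOf M (T ∪ W)).card ≤ 3 := by
  by_contra hcon
  set L := coloopsOf M (T ∪ W) with hL
  have hLW : L ⊆ W := coloopsOf_world_subset h hr
  have hLE : L ⊆ T ∪ W := hLW.trans Finset.subset_union_right
  -- `drk E L = 0`, so `nrk (E ∖ L) + |L| = 7`
  have hdrk : drk M (T ∪ W) L = 0 := by
    have := drk_union_coloops (world_subset h) (V := ∅) (Y := L) (Finset.Subset.refl _) (Finset.disjoint_empty_left L)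
    rw [Finset.empty_union, drk_empty] at this
    exact this
  have h1 := nrk_sdiff_add_card_eq (M := M) (T ∪ W) L
  rw [nrk_world h hr, hdrk] at h1
  -- `W ∖ L` is nonempty: `|L| ≤ 7` and `|L| = 7` would give rank `0 + 7`... pick `w ∈ W ∖ L`
  have hWL : (W \ L).Nonempty := by
    by_contra hne
    rw [Finset.not_nonempty_iff_eq_empty, Finset.sdiff_eq_empty_iff_subset] at hne
    have hLW' : L = W := Finset.Subset.antisymm hLW hne
    have hT : T ⊆ (T ∪ W) \ L := by
      intro t ht
      rw [Finset.mem_sdiff]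
      exact ⟨Finset.mem_union_left W ht, fun hh => Finset.disjoint_left.1 h.disj ht (hLW hh)⟩
    have h2 : nrk M T ≤ nrk M ((T ∪ W) \ L) := nrk_mono hT
    have h3 : nrk M T = 3 := nrk_eq_of_eRk h.T_rank
    have h4 : L.card = 7 := by rw [hLW', h.W_card]
    omega
  obtain ⟨w, hw⟩ := hWL
  rw [Finset.mem_sdiff] at hw
  have hins : insert w T ⊆ (T ∪ W) \ L := by
    intro e he
    rw [Finset.mem_insert] at he
    rw [Finset.mem_sdiff]
    rcases he with rfl | he
    · exact ⟨Finset.mem_union_right T hw.1, hw.2⟩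
    · exact ⟨Finset.mem_union_left W he, fun hh => Finset.disjoint_left.1 h.disj he (hLW hh)⟩
  have h4 : nrk M (insert w T) ≤ nrk M ((T ∪ W) \ L) := nrk_mono hins
  rw [nrk_insert_T h hw.1] at h4
  omega

/-- `drk E Z = drk E (Z ∖ L₀)` for `Z ⊆ E`: the coloops do not count. -/
theorem drk_eq_drk_sdiff_coloops {T W Z : Finset α} (h : ReducedWorld M T W) :
    drk M (T ∪ W) Z = drk M (T ∪ W) (Z \ coloopsOf M (T ∪ W)) := by
  have hsplit : Z = (Z \ coloopsOf M (T ∪ W)) ∪ (Z ∩ coloopsOf M (T ∪ W)) := by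
    ext e
    simp only [Finset.mem_union, Finset.mem_sdiff, Finset.mem_inter]
    tauto
  conv_lhs => rw [hsplit]
  exact drk_union_coloops (world_subset h) Finset.inter_subset_right
    (Finset.disjoint_left.2 (fun e he he' => (Finset.mem_sdiff.1 he).2 (Finset.mem_inter.1 he').2))

/-- **Nullity two through the series classes**: for `Z ⊆ W`, `drk E Z = 1` iff `Z ∖ L₀` is a nonempty subset of one
series class of `E`. -/
theorem drk_eq_one_iff_subset_serClass {T W Z : Finset α} (h : ReducedWorld M T W) (hZ : Z ⊆ T ∪ W) :
    drk M (T ∪ W) Z = 1 ↔ (Z \ coloopsOf M (T ∪ W)).Nonempty ∧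
      ∃ N ∈ serClasses M (T ∪ W), Z \ coloopsOf M (T ∪ W) ⊆ N := by
  rw [drk_eq_drk_sdiff_coloops h]
  have hE := world_subset h
  have hsub : Z \ coloopsOf M (T ∪ W) ⊆ cyclicPart M (T ∪ W) := by
    intro e he
    rw [Finset.mem_sdiff] at he
    exact Finset.mem_sdiff.2 ⟨hZ he.1, he.2⟩
  constructor
  · intro h1
    have hne : (Z \ coloopsOf M (T ∪ W)).Nonempty := by
      by_contra hne
      rw [Finset.not_nonempty_iff_eq_empty] at hne
      rw [hne, drk_empty] at h1
      omega
    obtain ⟨e, he⟩ := hne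
    refine ⟨⟨e, he⟩, serClass M (T ∪ W) e, mem_serClasses.2 ⟨e, hsub he, rfl⟩, ?_⟩
    intro f hf
    rw [mem_serClass]
    exact ⟨hsub hf, pairwise_ser_of_drk_le_one hE hsub (by omega) e he f hf⟩
  · rintro ⟨hne, N, hN, hZN⟩
    exact drk_eq_one_of_subset_serClass hE hN hZN hne

/-- A point of the world outside `Z` is a coloop of `E ∖ Z` iff adding it to `Z` keeps the dual rank. -/
theorem mem_coloopsOf_sdiff_iff {T W Z : Finset α} (h : ReducedWorld M T W) (hr : M.eRank = 7) {e : α}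
    (he : e ∈ (T ∪ W) \ Z) :
    e ∈ coloopsOf M ((T ∪ W) \ Z) ↔ drk M (T ∪ W) (insert e Z) = drk M (T ∪ W) Z := by
  have hE := world_subset h
  rw [mem_coloopsOf_iff_nrk (Finset.sdiff_subset.trans hE)]
  have h1 := nrk_sdiff_add_card_eq (M := M) (T ∪ W) Z
  have h2 := nrk_sdiff_add_card_eq (M := M) (T ∪ W) (insert e Z)
  have heZ : e ∉ Z := (Finset.mem_sdiff.1 he).2
  have heq : (T ∪ W) \ insert e Z = ((T ∪ W) \ Z).erase e := by
    ext x
    simp only [Finset.mem_sdiff, Finset.mem_insert, Finset.mem_erase]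
    tauto
  rw [heq, Finset.card_insert_of_notMem heZ] at h2
  rw [nrk_world h hr] at h1 h2
  constructor
  · rintro ⟨-, h3⟩
    omega
  · intro h3
    exact ⟨he, by omega⟩

/-- **The coloops of a nullity-two witness**: for `Z ⊆ W` with `Z ∖ L₀ ⊆ N` nonempty (`N` a series class of `E`),
the coloops of `E ∖ Z` are `(N ∪ L₀) ∖ Z`. -/
theorem coloopsOf_of_drk_one {T W Z N : Finset α} (h : ReducedWorld M T W) (hr : M.eRank = 7) (hZ : Z ⊆ T ∪ W)
    (hN : N ∈ serClasses M (T ∪ W)) (hZN : Z \ coloopsOf M (T ∪ W) ⊆ N) (hne : (Z \ coloopsOf M (T ∪ W)).Nonempty) :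
    coloopsOf M ((T ∪ W) \ Z) = (N ∪ coloopsOf M (T ∪ W)) \ Z := by
  have hE := world_subset h
  have hd1 : drk M (T ∪ W) Z = 1 := (drk_eq_one_iff_subset_serClass h hZ).2 ⟨hne, N, hN, hZN⟩
  have hNsub : N ⊆ cyclicPart M (T ∪ W) := by
    obtain ⟨f, -, rfl⟩ := mem_serClasses.1 hN
    exact serClass_subset _ f
  ext e
  constructor
  · intro he
    have heE : e ∈ (T ∪ W) \ Z := coloopsOf_subset M _ he
    rw [mem_coloopsOf_sdiff_iff h hr heE, hd1] at he
    rw [Finset.mem_sdiff, Finset.mem_union]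
    refine ⟨?_, (Finset.mem_sdiff.1 heE).2⟩
    by_cases hL : e ∈ coloopsOf M (T ∪ W)
    · exact Or.inr hL
    left
    -- `e ∉ L₀`: `(insert e Z) ∖ L₀ = insert e (Z ∖ L₀)` has dual rank `1`, so `e` is in series with `Z ∖ L₀ ⊆ N`
    rw [drk_eq_drk_sdiff_coloops h] at he
    have heq : insert e Z \ coloopsOf M (T ∪ W) = insert e (Z \ coloopsOf M (T ∪ W)) := by
      ext x
      simp only [Finset.mem_sdiff, Finset.mem_insert]
      constructor
      · rintro ⟨hx | hx, hx'⟩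
        · exact Or.inl hx
        · exact Or.inr ⟨hx, hx'⟩
      · rintro (rfl | ⟨hx, hx'⟩)
        · exact ⟨Or.inl rfl, hL⟩
        · exact ⟨Or.inr hx, hx'⟩
    rw [heq] at he
    have hecyc : e ∈ cyclicPart M (T ∪ W) := Finset.mem_sdiff.2 ⟨(Finset.mem_sdiff.1 heE).1, hL⟩
    have hsub : insert e (Z \ coloopsOf M (T ∪ W)) ⊆ cyclicPart M (T ∪ W) :=
      Finset.insert_subset hecyc (hZN.trans hNsub)
    obtain ⟨z, hz⟩ := hne
    have hser := pairwise_ser_of_drk_le_one hE hsub (by omega) e (Finset.mem_insert_self _ _) z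
      (Finset.mem_insert_of_mem hz)
    rw [eq_serClass_of_mem hE hN (hZN hz), mem_serClass]
    exact ⟨hecyc, ser_symm hser⟩
  · intro he
    rw [Finset.mem_sdiff, Finset.mem_union] at he
    have heE : e ∈ (T ∪ W) \ Z := by
      rw [Finset.mem_sdiff]
      refine ⟨?_, he.2⟩
      rcases he.1 with hh | hh
      · exact cyclicPart_subset M _ (hNsub hh)
      · exact coloopsOf_subset M _ hh
    rw [mem_coloopsOf_sdiff_iff h hr heE, hd1]
    rcases he.1 with hh | hh
    · -- `e ∈ N`: `insert e Z` still has `(insert e Z) ∖ L₀ ⊆ N` nonempty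
      apply (drk_eq_one_iff_subset_serClass h (Finset.insert_subset (Finset.mem_sdiff.1 heE).1 hZ)).2
      refine ⟨hne.mono (Finset.sdiff_subset_sdiff (Finset.subset_insert e Z) (Finset.Subset.refl _)), N, hN, ?_⟩
      intro x hx
      rw [Finset.mem_sdiff, Finset.mem_insert] at hx
      rcases hx.1 with rfl | hx1
      · exact hh
      · exact hZN (Finset.mem_sdiff.2 ⟨hx1, hx.2⟩)
    · -- `e ∈ L₀`: a coloop does not change the dual rank
      have := drk_union_coloops hE (V := Z) (Y := {e}) (Finset.singleton_subset_iff.2 hh)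
        (Finset.disjoint_singleton_right.2 he.2)
      rw [Finset.union_comm Z {e}, ← Finset.insert_eq] at this
      rw [this, hd1]

end SevenThree

end PercRepro
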